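import Literature.Probability.LatticeModels.StrongHarrisKleitman
import Literature.Probability.Percolation.StrongHarrisThreePoint
import Summits.CriticalPhenomena.PercolationContinuityZ3.Theorems.PercNearOneGluingNoHeavyLowerTailSunflowerCubicStep
import HarnessLib

/-!
# `NoHeavyLowerTail` (stmt-CriticalPhenomena-4575) — the cubic sunflower inequality (lattice AG⁺) from a
# GOOD COORDINATE, and the three-point inequalities AG⁺ / SHK3⁺ it yields for every weighted graph

Support file (new-inequality factory, all-graph proof seat `prim-ineq-prove-4` gen 2; `--supports
stmt-CriticalPhenomena-4575`).  No definitions, no named facts, no sorries.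

Setting: `μ = prodBernoulli p` on `Set ι`; a THREE-PETAL SUNFLOWER SYSTEM over a finite coordinate set `F` is a core
`A`, petals `C 0, C 1, C 2` (pairwise disjoint, disjoint from `A`, each `A ∪ C i` and `A` closed upwards) and the outside
`B = (A ∪ ⋃ C i)ᶜ`, all determined by `F` (exactly the hypotheses of
`Literature.Probability.LatticeModels.StrongHarris.core`, Gladkov's `μ(A)μ(B) ≥ e₂(μ(C))`).  The conjectured cubic
strengthening ("lattice AG⁺" = prove-2's CSH₃; 0 violations in an exhaustive census of the 4-cube and samples up to the
6-cube, memo `run/shared/lean/prim/prim-ineq-prove-4/MEMO-AGPLUS-LATTICE.md`) is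

  `μ(A) μ(B) ≥ e₂(μ(C)) + e₃(μ(C))`.

For a coordinate `e` write `X¹ = insert e ⁻¹' X`, `X⁰ = (· \ {e}) ⁻¹' X` for the sections and
`d = μ(B⁰ ∩ A¹)`, `cp i = μ(C⁰ i ∩ A¹)`, `cm i = μ(B⁰ ∩ C¹ i)` (the masses moved by `e` from the outside to the core,
from petal `i` to the core, from the outside to petal `i`), `α = d + Σ cp`, `β = d + Σ cm`, `δ i = cm i − cp i`,
`u i = μ(C i)`.  The coordinate `e` is GOOD if

  `L_e := α β + (1 + u 2) δ₀δ₁ + (1 + u 1) δ₀δ₂ + (1 + u 0) δ₁δ₂ + (1 − 2 p_e) δ₀δ₁δ₂ ≥ 0`;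

by `SunflowerCubicStep.step_identity` (landed) `L_e` is exactly the defect in
`Φ(system) = (1−p_e) Φ(0-section) + p_e Φ(1-section) + p_e(1−p_e) L_e`, `Φ = μ(A)μ(B) − e₂ − e₃`.

* `SunflowerCubic.core` — **if every three-petal sunflower system of cylinder events over a nonempty coordinate set
  has a good coordinate in that set, then lattice AG⁺ holds for every such system** (strong induction on the
  coordinate set, removing a good coordinate; the measure-level bookkeeping of the twelve refined cell masses is done
  here, the arithmetic is `step_identity`).  The finite-index-type form and the percolation corollaries (three-point
  AG⁺ and SHK3⁺ for every weighted graph) are in the companion file `…SunflowerCubicThreePoint.lean`.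
The hypothesis (EXISTS-GOOD-COORDINATE) holds in every one of > 2 600 random and several hundred adversarially
optimised systems of the census (memo §4, §6; at three coordinates every coordinate is good); it is the one open
combinatorial statement of this route to AG⁺ / SHK3⁺.  Not used: any unproved fact — the hypothesis is an explicit
binder.
-/

noncomputable section

namespace Summit.CriticalPhenomena.PercolationContinuityZ3.Theorems

open MeasureTheory Literature.Probability.LatticeModels Literature.Probability.LatticeModels.StrongHarris
open Literature.Probability.Percolation

namespace SunflowerCubic

variable {ι : Type*}

/-- Three reals in `{0,1}` with sum `≤ 1` have vanishing pairwise and triple products. [folklore] -/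
theorem e23_eq_zero_of_01 {c₀ c₁ c₂ : ℝ} (h0 : c₀ = 0 ∨ c₀ = 1) (h1 : c₁ = 0 ∨ c₁ = 1)
    (h2 : c₂ = 0 ∨ c₂ = 1) (hle : c₀ + c₁ + c₂ ≤ 1) :
    c₀ * c₁ + c₀ * c₂ + c₁ * c₂ + c₀ * c₁ * c₂ = 0 := by
  rcases h0 with h0 | h0 <;> rcases h1 with h1 | h1 <;> rcases h2 with h2 | h2 <;> subst h0 h1 h2 <;>
    linarith

/-- **Lattice AG⁺ from a good coordinate (cylinder-event form, the induction).**  See the module docstring: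
if every three-petal sunflower system of cylinder events over a nonempty finite coordinate set `F` has a GOOD
coordinate `e ∈ F` (`L_e ≥ 0`), then every such system satisfies `e₂(μ(C)) + e₃(μ(C)) ≤ μ(A) μ(B)`.
[cite: Gladkov2024StrongFKG, Thm. 2.1 (the induction shell); this file] -/
theorem core [DecidableEq ι] (p : ι → unitInterval)
    (hgood : ∀ (F : Finset ι) (A B : Set (Set ι)) (C : Fin 3 → Set (Set ι)), F.Nonempty →
      (∀ i ∈ (Finset.univ : Finset (Fin 3)), ∀ j ∈ (Finset.univ : Finset (Fin 3)), i ≠ j →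
        Disjoint (C i) (C j)) →
      (∀ i ∈ (Finset.univ : Finset (Fin 3)), Disjoint A (C i)) →
      (∀ i ∈ (Finset.univ : Finset (Fin 3)), IsUpperSet (A ∪ C i)) → IsUpperSet A →
      (∀ ω, ω ∈ B ↔ ω ∉ A ∧ ∀ i ∈ (Finset.univ : Finset (Fin 3)), ω ∉ C i) →
      DeterminedBy A (↑F : Set ι) → (∀ i ∈ (Finset.univ : Finset (Fin 3)), DeterminedBy (C i) (↑F : Set ι)) →
      ∃ e ∈ F,
        0 ≤ ((prodBernoulli p).real (((· \ {e}) ⁻¹' B) ∩ (insert e ⁻¹' A)) +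
                ((prodBernoulli p).real (((· \ {e}) ⁻¹' C 0) ∩ (insert e ⁻¹' A)) +
                  (prodBernoulli p).real (((· \ {e}) ⁻¹' C 1) ∩ (insert e ⁻¹' A)) +
                  (prodBernoulli p).real (((· \ {e}) ⁻¹' C 2) ∩ (insert e ⁻¹' A)))) *
              ((prodBernoulli p).real (((· \ {e}) ⁻¹' B) ∩ (insert e ⁻¹' A)) +
                ((prodBernoulli p).real (((· \ {e}) ⁻¹' B) ∩ (insert e ⁻¹' C 0)) +
                  (prodBernoulli p).real (((· \ {e}) ⁻¹' B) ∩ (insert e ⁻¹' C 1)) +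
                  (prodBernoulli p).real (((· \ {e}) ⁻¹' B) ∩ (insert e ⁻¹' C 2)))) +
            ((1 + (prodBernoulli p).real (C 2)) *
                (((prodBernoulli p).real (((· \ {e}) ⁻¹' B) ∩ (insert e ⁻¹' C 0)) -
                    (prodBernoulli p).real (((· \ {e}) ⁻¹' C 0) ∩ (insert e ⁻¹' A))) *
                  ((prodBernoulli p).real (((· \ {e}) ⁻¹' B) ∩ (insert e ⁻¹' C 1)) -
                    (prodBernoulli p).real (((· \ {e}) ⁻¹' C 1) ∩ (insert e ⁻¹' A)))) +
              (1 + (prodBernoulli p).real (C 1)) *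
                (((prodBernoulli p).real (((· \ {e}) ⁻¹' B) ∩ (insert e ⁻¹' C 0)) -
                    (prodBernoulli p).real (((· \ {e}) ⁻¹' C 0) ∩ (insert e ⁻¹' A))) *
                  ((prodBernoulli p).real (((· \ {e}) ⁻¹' B) ∩ (insert e ⁻¹' C 2)) -
                    (prodBernoulli p).real (((· \ {e}) ⁻¹' C 2) ∩ (insert e ⁻¹' A)))) +
              (1 + (prodBernoulli p).real (C 0)) *
                (((prodBernoulli p).real (((· \ {e}) ⁻¹' B) ∩ (insert e ⁻¹' C 1)) -
                    (prodBernoulli p).real (((· \ {e}) ⁻¹' C 1) ∩ (insert e ⁻¹' A))) *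
                  ((prodBernoulli p).real (((· \ {e}) ⁻¹' B) ∩ (insert e ⁻¹' C 2)) -
                    (prodBernoulli p).real (((· \ {e}) ⁻¹' C 2) ∩ (insert e ⁻¹' A))))) +
          (1 - 2 * (p e : ℝ)) *
            ((((prodBernoulli p).real (((· \ {e}) ⁻¹' B) ∩ (insert e ⁻¹' C 0)) -
                  (prodBernoulli p).real (((· \ {e}) ⁻¹' C 0) ∩ (insert e ⁻¹' A))) *
                ((prodBernoulli p).real (((· \ {e}) ⁻¹' B) ∩ (insert e ⁻¹' C 1)) -
                  (prodBernoulli p).real (((· \ {e}) ⁻¹' C 1) ∩ (insert e ⁻¹' A)))) *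
              ((prodBernoulli p).real (((· \ {e}) ⁻¹' B) ∩ (insert e ⁻¹' C 2)) -
                (prodBernoulli p).real (((· \ {e}) ⁻¹' C 2) ∩ (insert e ⁻¹' A)))))
    (n : ℕ) :
    ∀ (F : Finset ι), F.card = n → ∀ (A B : Set (Set ι)) (C : Fin 3 → Set (Set ι)),
      (∀ i ∈ (Finset.univ : Finset (Fin 3)), ∀ j ∈ (Finset.univ : Finset (Fin 3)), i ≠ j →
        Disjoint (C i) (C j)) →
      (∀ i ∈ (Finset.univ : Finset (Fin 3)), Disjoint A (C i)) →
      (∀ i ∈ (Finset.univ : Finset (Fin 3)), IsUpperSet (A ∪ C i)) → IsUpperSet A →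
      (∀ ω, ω ∈ B ↔ ω ∉ A ∧ ∀ i ∈ (Finset.univ : Finset (Fin 3)), ω ∉ C i) →
      DeterminedBy A (↑F : Set ι) → (∀ i ∈ (Finset.univ : Finset (Fin 3)), DeterminedBy (C i) (↑F : Set ι)) →
      (prodBernoulli p).real (C 0) * (prodBernoulli p).real (C 1) +
            (prodBernoulli p).real (C 0) * (prodBernoulli p).real (C 2) +
            (prodBernoulli p).real (C 1) * (prodBernoulli p).real (C 2) +
          (prodBernoulli p).real (C 0) * (prodBernoulli p).real (C 1) * (prodBernoulli p).real (C 2) ≤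
        (prodBernoulli p).real A * (prodBernoulli p).real B := by
  set μ := prodBernoulli p with hμ
  induction n using Nat.strong_induction_on with
  | _ n ih =>
    intro F hFn A B C hdisj hdisjA hup hupA hB hA hC
    rcases F.eq_empty_or_nonempty with hF0 | hFne
    · -- `F = ∅`: every event is `∅` or `univ`; the petals are disjoint, so all products vanish
      subst hF0
      have triv : ∀ X : Set (Set ι), DeterminedBy X (↑(∅ : Finset ι) : Set ι) →
          X = ∅ ∨ X = Set.univ := by
        intro X hX
        rw [determinedBy_iff] at hX
        by_cases hne : X.Nonempty
        · obtain ⟨ω₀, hω₀⟩ := hne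
          exact Or.inr (Set.eq_univ_of_forall fun ω => (hX ω ω₀ (by simp)).2 hω₀)
        · exact Or.inl (Set.not_nonempty_iff_eq_empty.1 hne)
      have hc01 : ∀ i ∈ (Finset.univ : Finset (Fin 3)), μ.real (C i) = 0 ∨ μ.real (C i) = 1 := by
        intro i hi
        rcases triv (C i) (hC i hi) with h | h
        · exact Or.inl (by rw [h, measureReal_empty])
        · exact Or.inr (by rw [h, probReal_univ])
      have hle1 : ∑ i ∈ (Finset.univ : Finset (Fin 3)), μ.real (C i) ≤ 1 := by
        rw [← measureReal_biUnion_finset (μ := μ)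
          (fun i hi j hj hij => hdisj i (Finset.mem_coe.1 hi) j (Finset.mem_coe.1 hj) hij)
          (fun i hi => (hC i hi).measurableSet_of_finset) (fun i _ => measure_ne_top _ _)]
        exact (measureReal_mono (Set.subset_univ _) (measure_ne_top _ _)).trans_eq probReal_univ
      rw [Fin.sum_univ_three] at hle1
      have hAB : 0 ≤ μ.real A * μ.real B := by positivity
      have hz := e23_eq_zero_of_01 (hc01 0 (Finset.mem_univ _)) (hc01 1 (Finset.mem_univ _))
        (hc01 2 (Finset.mem_univ _)) hle1
      linarith
    · -- `F ≠ ∅`: remove a GOOD coordinate `e ∈ F`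
      obtain ⟨e, heF, hLe⟩ := hgood F A B C hFne hdisj hdisjA hup hupA hB hA hC
      set F' := F.erase e with hF'd
      have hFins : insert e F' = F := Finset.insert_erase heF
      have hcard : F'.card < n := by
        rw [hF'd, Finset.card_erase_of_mem heF, hFn]
        exact Nat.sub_lt (by rw [← hFn]; exact Finset.card_pos.2 hFne) Nat.one_pos
      -- notation for the sections
      set A₁ := insert e ⁻¹' A with hA₁d
      set A₀ := (· \ {e}) ⁻¹' A with hA₀d
      set B₁ := insert e ⁻¹' B with hB₁d
      set B₀ := (· \ {e}) ⁻¹' B with hB₀d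
      set C₁ : Fin 3 → Set (Set ι) := fun i => insert e ⁻¹' C i with hC₁d
      set C₀ : Fin 3 → Set (Set ι) := fun i => (· \ {e}) ⁻¹' C i with hC₀d
      have hle : ∀ ω : Set ι, ω \ {e} ≤ insert e ω := fun ω =>
        (Set.sdiff_subset).trans (Set.subset_insert e ω)
      -- the sections are again systems of cylinder events, now over `F'`
      have hA' : DeterminedBy A (↑(insert e F') : Set ι) := by rw [hFins]; exact hA
      have hC' : ∀ i ∈ (Finset.univ : Finset (Fin 3)), DeterminedBy (C i) (↑(insert e F') : Set ι) := by
        intro i hi; rw [hFins]; exact hC i hi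
      have hBdet : DeterminedBy B (↑(insert e F') : Set ι) := determinedBy_bottom hB hA' hC'
      have hBdetF : DeterminedBy B (↑F : Set ι) := by rw [← hFins]; exact hBdet
      have hA₁ : DeterminedBy A₁ (↑F' : Set ι) := determinedBy_preimage_insert hA'
      have hA₀ : DeterminedBy A₀ (↑F' : Set ι) := determinedBy_preimage_sdiff hA'
      have hB₁ : DeterminedBy B₁ (↑F' : Set ι) := determinedBy_preimage_insert hBdet
      have hB₀ : DeterminedBy B₀ (↑F' : Set ι) := determinedBy_preimage_sdiff hBdet
      have hC₁ : ∀ i ∈ (Finset.univ : Finset (Fin 3)), DeterminedBy (C₁ i) (↑F' : Set ι) := fun i hi =>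
        determinedBy_preimage_insert (hC' i hi)
      have hC₀ : ∀ i ∈ (Finset.univ : Finset (Fin 3)), DeterminedBy (C₀ i) (↑F' : Set ι) := fun i hi =>
        determinedBy_preimage_sdiff (hC' i hi)
      -- induction hypotheses for the two sections
      have ih₁ := ih F'.card hcard F' rfl A₁ B₁ C₁ (fun i hi j hj hij => (hdisj i hi j hj hij).preimage _)
        (fun i hi => (hdisjA i hi).preimage _)
        (fun i hi => isUpperSet_preimage_insert (hup i hi)) (isUpperSet_preimage_insert hupA)
        (fun ω => by simpa [hB₁d, hA₁d, hC₁d] using hB (insert e ω)) hA₁ hC₁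
      have ih₀ := ih F'.card hcard F' rfl A₀ B₀ C₀ (fun i hi j hj hij => (hdisj i hi j hj hij).preimage _)
        (fun i hi => (hdisjA i hi).preimage _)
        (fun i hi => isUpperSet_preimage_sdiff (hup i hi)) (isUpperSet_preimage_sdiff hupA)
        (fun ω => by simpa [hB₀d, hA₀d, hC₀d] using hB (ω \ {e})) hA₀ hC₀
      -- measurability of everything in sight (cylinder events over `F'`)
      have mA₁ : MeasurableSet A₁ := hA₁.measurableSet_of_finset
      have mA₀ : MeasurableSet A₀ := hA₀.measurableSet_of_finset
      have mB₀ : MeasurableSet B₀ := hB₀.measurableSet_of_finset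
      have mB₁ : MeasurableSet B₁ := hB₁.measurableSet_of_finset
      have mC₁ : ∀ i ∈ (Finset.univ : Finset (Fin 3)), MeasurableSet (C₁ i) := fun i hi =>
        (hC₁ i hi).measurableSet_of_finset
      have mC₀ : ∀ i ∈ (Finset.univ : Finset (Fin 3)), MeasurableSet (C₀ i) := fun i hi =>
        (hC₀ i hi).measurableSet_of_finset
      -- the twelve refined masses
      set a₀ : ℝ := μ.real A₀ with ha₀
      set b₁ : ℝ := μ.real B₁ with hb₁
      set d : ℝ := μ.real (B₀ ∩ A₁) with hd
      set cp : Fin 3 → ℝ := fun i => μ.real (C₀ i ∩ A₁) with hcp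
      set co : Fin 3 → ℝ := fun i => μ.real (C₀ i ∩ C₁ i) with hco
      set cm : Fin 3 → ℝ := fun i => μ.real (B₀ ∩ C₁ i) with hcm
      have hBC : ∀ i ∈ (Finset.univ : Finset (Fin 3)), Disjoint B (C i) := fun i hi =>
        Set.disjoint_left.2 fun ω hω hCω => ((hB ω).1 hω).2 i hi hCω
      have hBA : Disjoint B A := Set.disjoint_left.2 fun ω hω hAω => ((hB ω).1 hω).1 hAω
      -- every configuration lies in `A`, in `B`, or in some petal
      have htri : ∀ ω : Set ι, ω ∈ A ∨ ω ∈ B ∨ ∃ i, ω ∈ C i := by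
        intro ω
        by_cases h1 : ω ∈ A
        · exact Or.inl h1
        by_cases h2 : ∃ i, ω ∈ C i
        · exact Or.inr (Or.inr h2)
        · exact Or.inr (Or.inl ((hB ω).2 ⟨h1, fun i _ hi => h2 ⟨i, hi⟩⟩))
      -- `μ(C_i¹) = co_i + cm_i`
      have hc₁ : ∀ i ∈ (Finset.univ : Finset (Fin 3)), μ.real (C₁ i) = co i + cm i := by
        intro i hi
        have hset : C₁ i = (C₀ i ∩ C₁ i) ∪ (B₀ ∩ C₁ i) := by
          ext ω
          simp only [Set.mem_union, Set.mem_inter_iff, hC₁d, hC₀d, hB₀d, Set.mem_preimage]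
          constructor
          · intro hω
            rcases bottom_or_same_of_le hdisj hdisjA hup hupA hB hi (hle ω) hω with hB' | hC'
            · exact Or.inr ⟨hB', hω⟩
            · exact Or.inl ⟨hC', hω⟩
          · rintro (⟨-, h1⟩ | ⟨-, h1⟩) <;> exact h1
        have hdj : Disjoint (C₀ i ∩ C₁ i) (B₀ ∩ C₁ i) :=
          Set.disjoint_left.2 fun ω h1 h2 => Set.disjoint_left.1 (hBC i hi) h2.1 h1.1
        rw [hco, hcm]
        simp only
        rw [← measureReal_union hdj (mB₀.inter (mC₁ i hi)) (measure_ne_top _ _) (measure_ne_top _ _),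
          ← hset]
      -- `μ(C_i⁰) = co_i + cp_i`
      have hc₀ : ∀ i ∈ (Finset.univ : Finset (Fin 3)), μ.real (C₀ i) = co i + cp i := by
        intro i hi
        have hset : C₀ i = (C₀ i ∩ C₁ i) ∪ (C₀ i ∩ A₁) := by
          ext ω
          simp only [Set.mem_union, Set.mem_inter_iff, hC₁d, hC₀d, hA₁d, Set.mem_preimage]
          constructor
          · intro hω
            rcases hup i hi (hle ω) (Or.inr hω) with hA'' | hC''
            · exact Or.inr ⟨hω, hA''⟩
            · exact Or.inl ⟨hω, hC''⟩
          · rintro (⟨h1, -⟩ | ⟨h1, -⟩) <;> exact h1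
        have hdj : Disjoint (C₀ i ∩ C₁ i) (C₀ i ∩ A₁) :=
          Set.disjoint_left.2 fun ω h1 h2 => Set.disjoint_left.1 (hdisjA i hi) h2.2 h1.2
        rw [hco, hcp]
        simp only
        rw [← measureReal_union hdj ((mC₀ i hi).inter mA₁) (measure_ne_top _ _) (measure_ne_top _ _),
          ← hset]
      -- `μ(A¹) = a₀ + d + Σ cp`
      have ha₁ : μ.real A₁ = a₀ + d + (cp 0 + cp 1 + cp 2) := by
        have hset : A₁ = (A₀ ∪ (B₀ ∩ A₁)) ∪ ⋃ i ∈ (Finset.univ : Finset (Fin 3)), (C₀ i ∩ A₁) := by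
          ext ω
          simp only [Set.mem_union, Set.mem_inter_iff, Set.mem_iUnion, exists_prop, Finset.mem_univ,
            true_and, hA₁d, hA₀d, hB₀d, hC₀d, Set.mem_preimage]
          constructor
          · intro hω
            rcases htri (ω \ {e}) with h | h | ⟨i, h⟩
            · exact Or.inl (Or.inl h)
            · exact Or.inl (Or.inr ⟨h, hω⟩)
            · exact Or.inr ⟨i, h, hω⟩
          · rintro ((h | ⟨-, h⟩) | ⟨i, -, h⟩)
            · exact hupA (hle ω) h
            · exact h
            · exact h
        have hpd : (↑(Finset.univ : Finset (Fin 3)) : Set (Fin 3)).PairwiseDisjoint fun i => C₀ i ∩ A₁ :=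
          fun i hi j hj hij => Set.disjoint_left.2 fun ω h1 h2 =>
            Set.disjoint_left.1 (hdisj i (Finset.mem_coe.1 hi) j (Finset.mem_coe.1 hj) hij) h1.1 h2.1
        have hd1 : Disjoint A₀ (B₀ ∩ A₁) :=
          Set.disjoint_left.2 fun ω h1 h2 => Set.disjoint_left.1 hBA h2.1 h1
        have hd2 : Disjoint (A₀ ∪ (B₀ ∩ A₁)) (⋃ i ∈ (Finset.univ : Finset (Fin 3)), (C₀ i ∩ A₁)) := by
          refine Set.disjoint_left.2 fun ω h1 h2 => ?_
          simp only [Set.mem_iUnion, Set.mem_inter_iff, exists_prop] at h2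
          obtain ⟨i, hi, h3, -⟩ := h2
          rcases h1 with h1 | ⟨h1, -⟩
          · exact Set.disjoint_left.1 (hdisjA i hi) h1 h3
          · exact Set.disjoint_left.1 (hBC i hi) h1 h3
        have hmU : MeasurableSet (⋃ i ∈ (Finset.univ : Finset (Fin 3)), (C₀ i ∩ A₁)) :=
          Finset.measurableSet_biUnion _ fun i hi => (mC₀ i hi).inter mA₁
        rw [hset, measureReal_union hd2 hmU (measure_ne_top _ _) (measure_ne_top _ _),
          measureReal_union hd1 (mB₀.inter mA₁) (measure_ne_top _ _) (measure_ne_top _ _),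
          measureReal_biUnion_finset hpd (fun i hi => (mC₀ i hi).inter mA₁) (fun i _ => measure_ne_top _ _),
          Fin.sum_univ_three]
      -- `μ(B⁰) = b₁ + d + Σ cm`
      have hb₀ : μ.real B₀ = b₁ + d + (cm 0 + cm 1 + cm 2) := by
        have hlow : IsLowerSet B := isLowerSet_bottom hup hupA hB
        have hset : B₀ = (B₁ ∪ (B₀ ∩ A₁)) ∪ ⋃ i ∈ (Finset.univ : Finset (Fin 3)), (B₀ ∩ C₁ i) := by
          ext ω
          simp only [Set.mem_union, Set.mem_inter_iff, Set.mem_iUnion, exists_prop, Finset.mem_univ,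
            true_and, hB₁d, hA₁d, hB₀d, hC₁d, Set.mem_preimage]
          constructor
          · intro hω
            rcases htri (insert e ω) with h | h | ⟨i, h⟩
            · exact Or.inl (Or.inr ⟨hω, h⟩)
            · exact Or.inl (Or.inl h)
            · exact Or.inr ⟨i, hω, h⟩
          · rintro ((h | ⟨h, -⟩) | ⟨i, h, -⟩)
            · exact hlow (hle ω) h
            · exact h
            · exact h
        have hpd : (↑(Finset.univ : Finset (Fin 3)) : Set (Fin 3)).PairwiseDisjoint fun i => B₀ ∩ C₁ i :=
          fun i hi j hj hij => Set.disjoint_left.2 fun ω h1 h2 =>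
            Set.disjoint_left.1 (hdisj i (Finset.mem_coe.1 hi) j (Finset.mem_coe.1 hj) hij) h1.2 h2.2
        have hd1 : Disjoint B₁ (B₀ ∩ A₁) :=
          Set.disjoint_left.2 fun ω h1 h2 => Set.disjoint_left.1 hBA h1 h2.2
        have hd2 : Disjoint (B₁ ∪ (B₀ ∩ A₁)) (⋃ i ∈ (Finset.univ : Finset (Fin 3)), (B₀ ∩ C₁ i)) := by
          refine Set.disjoint_left.2 fun ω h1 h2 => ?_
          simp only [Set.mem_iUnion, Set.mem_inter_iff, exists_prop] at h2
          obtain ⟨i, hi, -, h3⟩ := h2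
          rcases h1 with h1 | ⟨-, h1⟩
          · exact Set.disjoint_left.1 (hBC i hi) h1 h3
          · exact Set.disjoint_left.1 (hdisjA i hi) h1 h3
        have hmU : MeasurableSet (⋃ i ∈ (Finset.univ : Finset (Fin 3)), (B₀ ∩ C₁ i)) :=
          Finset.measurableSet_biUnion _ fun i hi => mB₀.inter (mC₁ i hi)
        rw [hset, measureReal_union hd2 hmU (measure_ne_top _ _) (measure_ne_top _ _),
          measureReal_union hd1 (mB₀.inter mA₁) (measure_ne_top _ _) (measure_ne_top _ _),
          measureReal_biUnion_finset hpd (fun i hi => mB₀.inter (mC₁ i hi)) (fun i _ => measure_ne_top _ _),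
          Fin.sum_univ_three]
      -- one-coordinate decompositions of the five masses
      have dA := real_eq_preimage_insert_add_preimage_sdiff p e hA
      have dB := real_eq_preimage_insert_add_preimage_sdiff p e hBdetF
      have dC : ∀ i ∈ (Finset.univ : Finset (Fin 3)),
          μ.real (C i) = p e * (co i + cm i) + (1 - p e) * (co i + cp i) := by
        intro i hi
        rw [hμ, real_eq_preimage_insert_add_preimage_sdiff p e (hC i hi), ← hμ, ← hc₁ i hi, ← hc₀ i hi]
      have dC0 := dC 0 (Finset.mem_univ _)
      have dC1 := dC 1 (Finset.mem_univ _)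
      have dC2 := dC 2 (Finset.mem_univ _)
      -- the induction hypotheses in the refined masses
      have ih₁' : (co 0 + cm 0) * (co 1 + cm 1) + (co 0 + cm 0) * (co 2 + cm 2) + (co 1 + cm 1) * (co 2 + cm 2) +
          (co 0 + cm 0) * (co 1 + cm 1) * (co 2 + cm 2) ≤ (a₀ + d + (cp 0 + cp 1 + cp 2)) * b₁ := by
        have h0 := hc₁ 0 (Finset.mem_univ _)
        have h1 := hc₁ 1 (Finset.mem_univ _)
        have h2 := hc₁ 2 (Finset.mem_univ _)
        simp only [hC₁d] at h0 h1 h2 ih₁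
        rw [h0, h1, h2, ha₁] at ih₁
        exact ih₁
      have ih₀' : (co 0 + cp 0) * (co 1 + cp 1) + (co 0 + cp 0) * (co 2 + cp 2) + (co 1 + cp 1) * (co 2 + cp 2) +
          (co 0 + cp 0) * (co 1 + cp 1) * (co 2 + cp 2) ≤ a₀ * (b₁ + d + (cm 0 + cm 1 + cm 2)) := by
        have h0 := hc₀ 0 (Finset.mem_univ _)
        have h1 := hc₀ 1 (Finset.mem_univ _)
        have h2 := hc₀ 2 (Finset.mem_univ _)
        simp only [hC₀d] at h0 h1 h2 ih₀
        rw [h0, h1, h2, hb₀] at ih₀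
        exact ih₀
      -- the good-coordinate hypothesis in the refined masses
      have hL : 0 ≤ (d + (cp 0 + cp 1 + cp 2)) * (d + (cm 0 + cm 1 + cm 2)) +
          ((1 + μ.real (C 2)) * ((cm 0 - cp 0) * (cm 1 - cp 1)) +
            (1 + μ.real (C 1)) * ((cm 0 - cp 0) * (cm 2 - cp 2)) +
            (1 + μ.real (C 0)) * ((cm 1 - cp 1) * (cm 2 - cp 2))) +
          (1 - 2 * (p e : ℝ)) * ((cm 0 - cp 0) * (cm 1 - cp 1) * (cm 2 - cp 2)) := by
        simpa [hd, hcp, hcm, hB₀d, hA₁d, hC₀d, hC₁d] using hLe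
      -- the arithmetic of the step
      have key := SunflowerCubicStep.step_identity (p e : ℝ) a₀ b₁ d (cp 0) (cp 1) (cp 2) (co 0) (co 1) (co 2)
        (cm 0) (cm 1) (cm 2)
      simp only at key
      have hp0 : 0 ≤ (p e : ℝ) := (p e).2.1
      have hp1 : (p e : ℝ) ≤ 1 := (p e).2.2
      have t0 : 0 ≤ (1 - (p e : ℝ)) * (a₀ * (b₁ + d + (cm 0 + cm 1 + cm 2)) -
          ((co 0 + cp 0) * (co 1 + cp 1) + (co 0 + cp 0) * (co 2 + cp 2) + (co 1 + cp 1) * (co 2 + cp 2)) -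
          (co 0 + cp 0) * (co 1 + cp 1) * (co 2 + cp 2)) := mul_nonneg (by linarith) (by linarith)
      have t1 : 0 ≤ (p e : ℝ) * ((a₀ + d + (cp 0 + cp 1 + cp 2)) * b₁ -
          ((co 0 + cm 0) * (co 1 + cm 1) + (co 0 + cm 0) * (co 2 + cm 2) + (co 1 + cm 1) * (co 2 + cm 2)) -
          (co 0 + cm 0) * (co 1 + cm 1) * (co 2 + cm 2)) := mul_nonneg hp0 (by linarith)
      have t2 := mul_nonneg (mul_nonneg (sub_nonneg.2 hp1) hp0) hL
      rw [dC0, dC1, dC2] at hL t2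
      rw [dA, dB, dC0, dC1, dC2, ha₁, hb₀]
      linarith [key, t0, t1, t2]

end SunflowerCubic

end Summit.CriticalPhenomena.PercolationContinuityZ3.Theorems
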